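import Summits.QuantumFields.QCD.Theses.NestedDissectionSea
import Literature.Barriers.QuantumFields.WilsonDeterminantSign
import Literature.Analysis.InnerProduct.CourantFischerBounds
import Literature.MathematicalPhysics.QuantumFieldTheory.QCDPhaseQuenched
import Summits.QuantumFields.QCD.Theorems.NestedDissectionSeaSeaFactorisationBridgeStubFrullaniToolkit

/-!
# Stub `stub_uvFunctionalContinuous` of line `proper-time-quarantine`
(crux `Summit.QuantumFields.QCD.Theses.NestedDissectionSea.SeaFactorisationBridge`, item stmt-QuantumFields-13880)

Continuity of the UV functional `F_{t₀}(U, μ) = ½ Σᵢ uvProfile t₀ (λᵢ(U)²)` in the gauge field `U`,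
where `λᵢ(U)` are the sorted eigenvalues of the Hermitian Wilson–Dirac matrix `Γ₅ D_W(U, μ, 1)` and
`uvProfile t₀ λ = −∫_{(0,t₀]} (e^{−tλ} − e^{−t})/t dt`.  This is the technical debt "T1" of the line
(wave-3 worker on `stub_complementCoercive`): every Lean statement about the reference expectation
`refExpect` (a ratio of Bochner integrals against the weight `exp(Σ_f F)`) needs the weight to be
measurable, and its denominator to be positive, before it says anything — continuity gives both.

Ingredients: Weyl's perturbation bound for the sorted eigenvalues (tree
`Literature.Analysis.InnerProduct.abs_eigenvalues_sub_eigenvalues_le`, transported to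
`Matrix.IsHermitian.eigenvalues`), the entrywise bound `|re ⟪M x, x⟫| ≤ (Σ_{ij} ‖M_{ij}‖) ‖x‖²`,
continuity of `U ↦ D_W(U)` (`continuous_wilsonDirac`), and the `t₀`-Lipschitz bound of the UV
profile on `[0, ∞)` (from the landed Frullani toolkit lemmas).
-/

noncomputable section

namespace Summit.QuantumFields.QCD.Cruxes.SeaFactorisationBridge.ProperTimeQuarantine

open scoped BigOperators Topology Classical MeasureTheory Matrix ComplexConjugate ComplexOrder InnerProductSpace
open Filter MeasureTheory
open Literature.MathematicalPhysics.QuantumFieldTheory Literature.MathematicalPhysics.QuantumLattice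
open Literature.Probability.LatticeModels
open Matrix

/-! ### Weyl's bound for `Matrix.IsHermitian.eigenvalues` -/

section Weyl

variable {n : Type*} [Fintype n] [DecidableEq n]

/-- Entrywise bound on the quadratic form of a matrix on Euclidean space:
`|re ⟪M x, x⟫| ≤ (Σ_{i,j} ‖M_{ij}‖) ‖x‖²`. [folklore] -/
theorem abs_re_inner_toEuclideanLin_le (M : Matrix n n ℂ) (x : EuclideanSpace ℂ n) :
    |RCLike.re ⟪toEuclideanLin M x, x⟫_ℂ| ≤ (∑ i, ∑ j, ‖M i j‖) * ‖x‖ ^ 2 := by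
  have hcoord : ∀ i, ‖x i‖ ≤ ‖x‖ := fun i => by
    have h := EuclideanSpace.norm_eq x
    have hi : ‖x i‖ ^ 2 ≤ ∑ j, ‖x j‖ ^ 2 :=
      Finset.single_le_sum (fun j _ => sq_nonneg ‖x j‖) (Finset.mem_univ i)
    calc ‖x i‖ = Real.sqrt (‖x i‖ ^ 2) := by rw [Real.sqrt_sq (norm_nonneg _)]
      _ ≤ Real.sqrt (∑ j, ‖x j‖ ^ 2) := Real.sqrt_le_sqrt hi
      _ = ‖x‖ := h.symm
  have hinner : ⟪toEuclideanLin M x, x⟫_ℂ = ∑ i, x i * star ((M *ᵥ ⇑x) i) := rfl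
  calc |RCLike.re ⟪toEuclideanLin M x, x⟫_ℂ| ≤ ‖⟪toEuclideanLin M x, x⟫_ℂ‖ := RCLike.abs_re_le_norm _
    _ = ‖∑ i, x i * star ((M *ᵥ ⇑x) i)‖ := by rw [hinner]
    _ ≤ ∑ i, ‖x i * star ((M *ᵥ ⇑x) i)‖ := norm_sum_le _ _
    _ = ∑ i, ‖x i‖ * ‖∑ j, M i j * x j‖ := by
        refine Finset.sum_congr rfl fun i _ => ?_
        rw [norm_mul, norm_star]
        rfl
    _ ≤ ∑ i, ‖x‖ * ∑ j, ‖M i j‖ * ‖x‖ := by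
        refine Finset.sum_le_sum fun i _ => ?_
        refine mul_le_mul (hcoord i) ((norm_sum_le _ _).trans (Finset.sum_le_sum fun j _ => ?_))
          (norm_nonneg _) (norm_nonneg _)
        rw [norm_mul]
        exact mul_le_mul_of_nonneg_left (hcoord j) (norm_nonneg _)
    _ = (∑ i, ∑ j, ‖M i j‖) * ‖x‖ ^ 2 := by
        rw [Finset.sum_mul]
        refine Finset.sum_congr rfl fun i _ => ?_
        rw [Finset.mul_sum, Finset.sum_mul]
        refine Finset.sum_congr rfl fun j _ => ?_
        ring

/-- **Weyl's perturbation bound for the sorted eigenvalues of Hermitian matrices**: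
`|λᵢ(B) − λᵢ(A)| ≤ Σ_{k,l} ‖(B − A)_{kl}‖` for every index `i`. [cite: HornJohnson2013, Cor 4.3.15] -/
theorem abs_eigenvalues_sub_eigenvalues_le_sum {A B : Matrix n n ℂ} (hA : A.IsHermitian)
    (hB : B.IsHermitian) (i : n) :
    |hB.eigenvalues i - hA.eigenvalues i| ≤ ∑ k, ∑ l, ‖(B - A) k l‖ := by
  have hc : ∀ x : EuclideanSpace ℂ n,
      |RCLike.re ⟪(toEuclideanLin B - toEuclideanLin A) x, x⟫_ℂ| ≤ (∑ k, ∑ l, ‖(B - A) k l‖) * ‖x‖ ^ 2 := by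
    intro x
    have h := abs_re_inner_toEuclideanLin_le (B - A) x
    rwa [map_sub] at h
  exact Literature.Analysis.InnerProduct.abs_eigenvalues_sub_eigenvalues_le
    (isSymmetric_toEuclideanLin_iff.mpr hA) (isSymmetric_toEuclideanLin_iff.mpr hB)
    finrank_euclideanSpace hc _

/-- **Continuity of the sorted eigenvalues of a continuous Hermitian family.** [folklore] -/
theorem continuous_eigenvalues_of_continuous {X : Type*} [TopologicalSpace X]
    {H : X → Matrix n n ℂ} (hH : Continuous H) (hHerm : ∀ x, (H x).IsHermitian) (i : n) :
    Continuous fun x => (hHerm x).eigenvalues i := by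
  refine continuous_iff_continuousAt.2 fun x₀ => ?_
  rw [ContinuousAt, tendsto_iff_norm_sub_tendsto_zero]
  have hbound : ∀ x, ‖(hHerm x).eigenvalues i - (hHerm x₀).eigenvalues i‖ ≤
      ∑ k, ∑ l, ‖(H x - H x₀) k l‖ := fun x => by
    rw [Real.norm_eq_abs]
    exact abs_eigenvalues_sub_eigenvalues_le_sum (hHerm x₀) (hHerm x) i
  have hlim : Tendsto (fun x => ∑ k, ∑ l, ‖(H x - H x₀) k l‖) (𝓝 x₀) (𝓝 0) := by
    have hc : Continuous fun x => ∑ k, ∑ l, ‖(H x - H x₀) k l‖ :=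
      continuous_finsetSum _ fun k _ => continuous_finsetSum _ fun l _ =>
        ((hH.matrix_elem k l).sub continuous_const).norm
    have h0 : (∑ k, ∑ l, ‖(H x₀ - H x₀) k l‖) = 0 := by simp
    simpa [h0] using hc.tendsto x₀
  exact squeeze_zero (fun x => norm_nonneg _) hbound hlim

end Weyl

/-! ### The UV profile is `t₀`-Lipschitz on `[0, ∞)` -/

/-- `|uvProfile t₀ a − uvProfile t₀ b| ≤ t₀ |a − b|` for `a, b ≥ 0`, `t₀ > 0`. [folklore] -/
theorem abs_uvIntegral_sub_le {t₀ a b : ℝ} (ht₀ : 0 < t₀) (ha : 0 ≤ a) (hb : 0 ≤ b) :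
    |(-∫ t in Set.Ioc 0 t₀, (Real.exp (-(t * a)) - Real.exp (-t)) / t) -
        (-∫ t in Set.Ioc 0 t₀, (Real.exp (-(t * b)) - Real.exp (-t)) / t)| ≤ t₀ * |a - b| := by
  have hia := frullani_integrableOn_Ioc (b := t₀) ha
  have hib := frullani_integrableOn_Ioc (b := t₀) hb
  have hsub : (-∫ t in Set.Ioc 0 t₀, (Real.exp (-(t * a)) - Real.exp (-t)) / t) -
      (-∫ t in Set.Ioc 0 t₀, (Real.exp (-(t * b)) - Real.exp (-t)) / t) =
      -∫ t in Set.Ioc 0 t₀, ((Real.exp (-(t * a)) - Real.exp (-t)) / t -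
        (Real.exp (-(t * b)) - Real.exp (-t)) / t) := by
    rw [integral_sub hia hib]
    ring
  rw [hsub, abs_neg]
  have h := norm_setIntegral_le_of_norm_le_const (μ := volume) (s := Set.Ioc 0 t₀)
    (C := |a - b|)
    (f := fun t : ℝ => (Real.exp (-(t * a)) - Real.exp (-t)) / t - (Real.exp (-(t * b)) - Real.exp (-t)) / t)
    measure_Ioc_lt_top (fun t ht => ?_)
  · rw [Real.norm_eq_abs, Real.volume_real_Ioc_of_le ht₀.le, sub_zero, mul_comm] at h
    exact h
  · rw [Real.norm_eq_abs]
    have ht : 0 < t := ht.1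
    have hsimp : (Real.exp (-(t * a)) - Real.exp (-t)) / t - (Real.exp (-(t * b)) - Real.exp (-t)) / t =
        (Real.exp (-(t * a)) - Real.exp (-(t * b))) / t := by
      field_simp
      ring
    rw [hsimp, abs_div, abs_of_pos ht, div_le_iff₀ ht]
    calc |Real.exp (-(t * a)) - Real.exp (-(t * b))| ≤ |t * a - t * b| :=
          frullani_abs_exp_neg_sub_le (mul_nonneg ht.le ha) (mul_nonneg ht.le hb)
      _ = |a - b| * t := by
          rw [← mul_sub, abs_mul, abs_of_pos ht, mul_comm]

/-- Continuity of `x ↦ uvProfile t₀ (f x)` for a continuous non-negative `f`. [folklore] -/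
theorem continuous_uvIntegral_comp {X : Type*} [TopologicalSpace X] {t₀ : ℝ} {f : X → ℝ}
    (hf : Continuous f) (hf0 : ∀ x, 0 ≤ f x) :
    Continuous fun x => -∫ t in Set.Ioc 0 t₀, (Real.exp (-(t * f x)) - Real.exp (-t)) / t := by
  rcases le_or_gt t₀ 0 with ht₀ | ht₀
  · have h : ∀ x, (-∫ t in Set.Ioc 0 t₀, (Real.exp (-(t * f x)) - Real.exp (-t)) / t) = 0 := fun x => by
      rw [Set.Ioc_eq_empty (not_lt.2 ht₀), Measure.restrict_empty, integral_zero_measure, neg_zero]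
    simp only [h]
    exact continuous_const
  refine continuous_iff_continuousAt.2 fun x₀ => ?_
  rw [ContinuousAt, tendsto_iff_norm_sub_tendsto_zero]
  have hbound : ∀ x, ‖(-∫ t in Set.Ioc 0 t₀, (Real.exp (-(t * f x)) - Real.exp (-t)) / t) -
      (-∫ t in Set.Ioc 0 t₀, (Real.exp (-(t * f x₀)) - Real.exp (-t)) / t)‖ ≤ t₀ * |f x - f x₀| :=
    fun x => by
      rw [Real.norm_eq_abs]
      exact abs_uvIntegral_sub_le ht₀ (hf0 x) (hf0 x₀)
  have hlim : Tendsto (fun x => t₀ * |f x - f x₀|) (𝓝 x₀) (𝓝 0) := by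
    have hc : Continuous fun x => t₀ * |f x - f x₀| :=
      continuous_const.mul (hf.sub continuous_const).abs
    simpa using hc.tendsto x₀
  exact squeeze_zero (fun x => norm_nonneg _) hbound hlim

/-! ### The registered stub -/

/-- `U ↦ Γ₅ D_W(U, μ, 1)` is continuous. [folklore] -/
theorem continuous_hermitianWilsonDirac {N : ℕ} [NeZero N] (μ : ℝ) :
    Continuous fun U : GaugeConfig 4 N (Matrix.specialUnitaryGroup (Fin 3) ℂ) =>
      Literature.Barriers.QuantumFields.WilsonDeterminant.hermitianWilsonDirac (fundamentalRep (Fin 3)) U μ 1 := by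
  unfold Literature.Barriers.QuantumFields.WilsonDeterminant.hermitianWilsonDirac
  exact continuous_const.matrix_mul (continuous_wilsonDirac _ (continuous_fundamentalRep (Fin 3)) μ 1)

/-- **Continuity of the UV functional in the gauge field** (registered stub
`stub_uvFunctionalContinuous`, skeleton def `UVFunctionalContinuous` unfolded): for every torus,
mass and proper time, `U ↦ ½ Σᵢ uvProfile t₀ (λᵢ(Γ₅ D_W(U, μ, 1))²)` is continuous. [folklore] -/
theorem stub_uvFunctionalContinuous :
    ∀ (N : ℕ) [NeZero N] (t₀ μ : ℝ),
      Continuous fun U : GaugeConfig 4 N (Matrix.specialUnitaryGroup (Fin 3) ℂ) =>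
        (1 / 2 : ℝ) * ∑ i, (-∫ t in Set.Ioc 0 t₀, (Real.exp (-(t *
          ((Literature.Barriers.QuantumFields.WilsonDeterminant.isHermitian_hermitianWilsonDirac
            (fundamentalRep (Fin 3)) fundamentalRep_mem_unitaryGroup U μ 1).eigenvalues i ^ 2))) -
            Real.exp (-t)) / t) := by
  intro N _ t₀ μ
  refine continuous_const.mul (continuous_finsetSum _ fun i _ => ?_)
  refine continuous_uvIntegral_comp (t₀ := t₀) ?_ (fun U => sq_nonneg _)
  exact (continuous_eigenvalues_of_continuous (continuous_hermitianWilsonDirac μ)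
    (fun U => Literature.Barriers.QuantumFields.WilsonDeterminant.isHermitian_hermitianWilsonDirac
      (fundamentalRep (Fin 3)) fundamentalRep_mem_unitaryGroup U μ 1) i).pow 2

end Summit.QuantumFields.QCD.Cruxes.SeaFactorisationBridge.ProperTimeQuarantine

end
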